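import Mathlib
import HarnessLib
import Literature.NumberTheory.Transcendental.KZCalculus
import Literature.NumberTheory.Transcendental.MZVSimplexRepProofs
import Summits.KontsevichZagierPeriods.KontsevichZagierPeriods.Theorems.LinRedNormalFormWheelThreeSpokesCharts

/-!
# Stub `stub_cellZetaMovesThree` of line `tame-bv-stokes` (crux `DihedralNormalForm`) — tools II

Support file for the stub `stub_cellZetaMovesThree` (the cell `ℓ = 3` of the cellular zeta
reduction): **the rotation chart.** In the coordinates `1 > t₀ > t₁ > t₂ > 0` of the open cell
`X` of `M_{0,6}(ℝ)` (marked points `(0, t₂, t₁, t₀, 1, ∞)`), the cyclic rotation of the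
hexagon is the rational map `σ(t) = (1 - t₂, (t₀ - t₂)/t₀, (t₁ - t₂)/t₁)` of `X` onto itself
(inverse `u ↦ ((1-u₀)/(1-u₁), (1-u₀)/(1-u₂), 1-u₀)`), with Jacobian determinant
`-t₂²/(t₀²t₁²)`. This file packages it as ONE change-of-variables move of the Kontsevich–Zagier
calculus together with the transport of existence of representations and of absolute
integrability in both directions (`cellZeta3_sigma_transport`, registered sub-goal
`stub_cellZetaMovesThreeAux2`), via the rational-chart tool `ratChart_transport` of
`LinRedNormalFormWheelThreeSpokesCharts`.

References: F. Brown, S. Carr, L. Schneps, *The algebra of cell-zeta values*, Compositio Math.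
146 (2010), §2 (dihedral coordinates), §4.4.1; M. Kontsevich, D. Zagier, *Periods* (2001), §1.2
rule (2).
-/

noncomputable section

open MeasureTheory Set MvPolynomial
open Literature.NumberTheory.Transcendental
open Literature.ModelTheory.ExponentialFields (IsSemialgebraic)
open Summit.KontsevichZagierPeriods.LinRedNormalForm.WheelThreeSpokes (ratChart_transport
  typedSimplex_eq_openOrderedSimplex)

namespace Summit.KontsevichZagierPeriods.DihedralNormalForm.TameBVStokes


/-- Membership in the open 3-simplex, typed. [folklore] -/
theorem cellZeta3_mem_simplex {t : Fin 3 → ℝ} :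
    t ∈ {t : Fin 3 → ℝ | (∀ i, 0 < t i) ∧ (∀ i, t i < 1) ∧ StrictAnti t} ↔
      1 > t 0 ∧ t 0 > t 1 ∧ t 1 > t 2 ∧ t 2 > 0 := by
  rw [show {t : Fin 3 → ℝ | (∀ i, 0 < t i) ∧ (∀ i, t i < 1) ∧ StrictAnti t} =
    KZ.openOrderedSimplex 3 from rfl, ← typedSimplex_eq_openOrderedSimplex]
  rfl

/-- Values of the rotation chart `σ(t) = (1 - t₂, (t₀ - t₂)/t₀, (t₁ - t₂)/t₁)`. [folklore] -/
theorem cellZeta3_sigma_apply (x : Fin 3 → ℝ) :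
    (fun i => aeval x ((![1 - X 2, X 0 - X 2, X 1 - X 2] : Fin 3 → MvPolynomial (Fin 3) ℚ) i) /
        aeval x ((![1, X 0, X 1] : Fin 3 → MvPolynomial (Fin 3) ℚ) i)) =
      ![1 - x 2, (x 0 - x 2) / x 0, (x 1 - x 2) / x 1] := by
  funext i; fin_cases i <;> simp

/-- The denominators of `σ` do not vanish on the simplex. [folklore] -/
theorem cellZeta3_sigma_Q_ne_zero :
    ∀ y ∈ {t : Fin 3 → ℝ | (∀ i, 0 < t i) ∧ (∀ i, t i < 1) ∧ StrictAnti t}, ∀ i,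
      aeval y ((![1, X 0, X 1] : Fin 3 → MvPolynomial (Fin 3) ℚ) i) ≠ 0 := by
  intro y hy i
  rw [cellZeta3_mem_simplex] at hy
  obtain ⟨h0, h01, h12, h2⟩ := hy
  have hy0 : y 0 ≠ 0 := by apply ne_of_gt; linarith
  have hy1 : y 1 ≠ 0 := by apply ne_of_gt; linarith
  fin_cases i <;> simp [hy0, hy1]

/-- The Jacobian denominator `t₀² t₁²` of `σ` does not vanish on the simplex. [folklore] -/
theorem cellZeta3_sigma_JQ_ne_zero :
    ∀ y ∈ {t : Fin 3 → ℝ | (∀ i, 0 < t i) ∧ (∀ i, t i < 1) ∧ StrictAnti t},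
      aeval y (X 0 ^ 2 * X 1 ^ 2 : MvPolynomial (Fin 3) ℚ) ≠ 0 := by
  intro y hy
  rw [cellZeta3_mem_simplex] at hy
  obtain ⟨h0, h01, h12, h2⟩ := hy
  have hy0 : y 0 ≠ 0 := by apply ne_of_gt; linarith
  have hy1 : y 1 ≠ 0 := by apply ne_of_gt; linarith
  simp [hy0, hy1]

/-- Jacobian determinant of `σ`: `-t₂²/(t₀² t₁²)`. [folklore] -/
theorem cellZeta3_sigma_det :
    ∀ y ∈ {t : Fin 3 → ℝ | (∀ i, 0 < t i) ∧ (∀ i, t i < 1) ∧ StrictAnti t}, (Matrix.of fun i j =>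
      (aeval y ((![1, X 0, X 1] : Fin 3 → MvPolynomial (Fin 3) ℚ) i))⁻¹ *
          aeval y (pderiv j ((![1 - X 2, X 0 - X 2, X 1 - X 2] : Fin 3 → MvPolynomial (Fin 3) ℚ) i)) -
        aeval y ((![1 - X 2, X 0 - X 2, X 1 - X 2] : Fin 3 → MvPolynomial (Fin 3) ℚ) i) /
          aeval y ((![1, X 0, X 1] : Fin 3 → MvPolynomial (Fin 3) ℚ) i) ^ 2 *
          aeval y (pderiv j ((![1, X 0, X 1] : Fin 3 → MvPolynomial (Fin 3) ℚ) i)) :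
      Matrix (Fin 3) (Fin 3) ℝ).det =
      aeval y (-(X 2 ^ 2) : MvPolynomial (Fin 3) ℚ) / aeval y (X 0 ^ 2 * X 1 ^ 2 : MvPolynomial (Fin 3) ℚ) := by
  intro y hy
  rw [cellZeta3_mem_simplex] at hy
  obtain ⟨h0, h01, h12, h2⟩ := hy
  have hy0 : y 0 ≠ 0 := by apply ne_of_gt; linarith
  have hy1 : y 1 ≠ 0 := by apply ne_of_gt; linarith
  simp [Matrix.det_fin_three]
  field_simp
  ring

/-- `σ` is injective on the simplex. [folklore] -/
theorem cellZeta3_sigma_injOn :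
    InjOn (fun (x : Fin 3 → ℝ) (i : Fin 3) =>
      aeval x ((![1 - X 2, X 0 - X 2, X 1 - X 2] : Fin 3 → MvPolynomial (Fin 3) ℚ) i) /
        aeval x ((![1, X 0, X 1] : Fin 3 → MvPolynomial (Fin 3) ℚ) i))
      {t : Fin 3 → ℝ | (∀ i, 0 < t i) ∧ (∀ i, t i < 1) ∧ StrictAnti t} := by
  intro x hx x' hx' h
  rw [cellZeta3_mem_simplex] at hx hx'
  obtain ⟨hx0, hx01, hx12, hx2⟩ := hx
  obtain ⟨hx0', hx01', hx12', hx2'⟩ := hx'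
  have h0 := congrFun h 0
  have h1 := congrFun h 1
  have h2 := congrFun h 2
  simp only [Matrix.cons_val_zero, Matrix.cons_val_one, Matrix.cons_val_two, Matrix.head_cons,
    Matrix.tail_cons, map_sub, map_one, aeval_X, div_one] at h0 h1 h2
  have e2 : x 2 = x' 2 := by linarith
  have hp0 : 0 < x 0 := by linarith
  have hp0' : 0 < x' 0 := by linarith
  have hp1 : 0 < x 1 := by linarith
  have hp1' : 0 < x' 1 := by linarith
  have e0 : x 0 = x' 0 := by
    rw [div_eq_div_iff hp0.ne' hp0'.ne'] at h1
    nlinarith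
  have e1 : x 1 = x' 1 := by
    rw [div_eq_div_iff hp1.ne' hp1'.ne'] at h2
    nlinarith
  funext i
  fin_cases i
  exacts [e0, e1, e2]

/-- `σ` maps the simplex onto itself (inverse `u ↦ ((1-u₀)/(1-u₁), (1-u₀)/(1-u₂), 1-u₀)`).
[folklore] -/
theorem cellZeta3_sigma_image :
    (fun (x : Fin 3 → ℝ) (i : Fin 3) =>
      aeval x ((![1 - X 2, X 0 - X 2, X 1 - X 2] : Fin 3 → MvPolynomial (Fin 3) ℚ) i) /
        aeval x ((![1, X 0, X 1] : Fin 3 → MvPolynomial (Fin 3) ℚ) i)) ''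
      {t : Fin 3 → ℝ | (∀ i, 0 < t i) ∧ (∀ i, t i < 1) ∧ StrictAnti t} =
      {t : Fin 3 → ℝ | (∀ i, 0 < t i) ∧ (∀ i, t i < 1) ∧ StrictAnti t} := by
  ext u
  constructor
  · rintro ⟨x, hx, rfl⟩
    rw [cellZeta3_mem_simplex] at hx
    obtain ⟨h0, h01, h12, h2⟩ := hx
    rw [cellZeta3_mem_simplex]
    simp only [Matrix.cons_val_zero, Matrix.cons_val_one, Matrix.cons_val_two, Matrix.head_cons,
      Matrix.tail_cons, map_sub, map_one, aeval_X, div_one, gt_iff_lt]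
    have hx0 : 0 < x 0 := by linarith
    have hx1 : 0 < x 1 := by linarith
    refine ⟨by linarith, ?_, ?_, ?_⟩
    · rw [div_lt_iff₀ hx0]; nlinarith
    · rw [div_lt_div_iff₀ hx1 hx0]; nlinarith
    · exact div_pos (by linarith) hx1
  · intro hu
    rw [cellZeta3_mem_simplex] at hu
    obtain ⟨h0, h01, h12, h2⟩ := hu
    have hu1 : 0 < 1 - u 1 := by linarith
    have hu2 : 0 < 1 - u 2 := by linarith
    have hu0 : 1 - u 0 ≠ 0 := ne_of_gt (by linarith)
    refine ⟨![(1 - u 0) / (1 - u 1), (1 - u 0) / (1 - u 2), 1 - u 0], ?_, ?_⟩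
    · rw [cellZeta3_mem_simplex]
      simp only [Matrix.cons_val_zero, Matrix.cons_val_one, Matrix.cons_val_two, Matrix.head_cons,
        Matrix.tail_cons, gt_iff_lt]
      refine ⟨?_, ?_, ?_, by linarith⟩
      · rw [div_lt_one hu1]; linarith
      · rw [div_lt_div_iff₀ hu2 hu1]; nlinarith
      · rw [lt_div_iff₀ hu2]; nlinarith
    · beta_reduce
      rw [cellZeta3_sigma_apply]
      funext i
      fin_cases i
      · simp
      · simp
        field_simp
        ring
      · simp
        field_simp
        ring

/-- |J| on the simplex. [folklore] -/
theorem cellZeta3_sigma_absJ :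
    ∀ y ∈ {t : Fin 3 → ℝ | (∀ i, 0 < t i) ∧ (∀ i, t i < 1) ∧ StrictAnti t},
      |aeval y (-(X 2 ^ 2) : MvPolynomial (Fin 3) ℚ) / aeval y (X 0 ^ 2 * X 1 ^ 2 : MvPolynomial (Fin 3) ℚ)|
        = y 2 ^ 2 / (y 0 ^ 2 * y 1 ^ 2) := by
  intro y hy
  rw [cellZeta3_mem_simplex] at hy
  obtain ⟨h0, h01, h12, h2⟩ := hy
  have hy0 : 0 < y 0 := by linarith
  have hy1 : 0 < y 1 := by linarith
  simp only [map_neg, map_pow, aeval_X, map_mul, neg_div, abs_neg]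
  exact abs_of_pos (by positivity)

/-- **Transport along `σ`**. [cite: KontsevichZagier2001, §1.2 rule (2)] -/
theorem cellZeta3_sigma_transport (h : (Fin 3 → ℝ) → ℝ) :
    (∀ r' : KZ.IntegralRep 3,
        r'.domain = {t : Fin 3 → ℝ | (∀ i, 0 < t i) ∧ (∀ i, t i < 1) ∧ StrictAnti t} →
        EqOn r'.integrand h r'.domain → ∃ r : KZ.IntegralRep 3,
          r.domain = {t : Fin 3 → ℝ | (∀ i, 0 < t i) ∧ (∀ i, t i < 1) ∧ StrictAnti t} ∧
          EqOn r.integrand (fun y => h ![1 - y 2, (y 0 - y 2) / y 0, (y 1 - y 2) / y 1] *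
            (y 2 ^ 2 / (y 0 ^ 2 * y 1 ^ 2))) r.domain) ∧
    (∀ r : KZ.IntegralRep 3,
        r.domain = {t : Fin 3 → ℝ | (∀ i, 0 < t i) ∧ (∀ i, t i < 1) ∧ StrictAnti t} →
        EqOn r.integrand (fun y => h ![1 - y 2, (y 0 - y 2) / y 0, (y 1 - y 2) / y 1] *
            (y 2 ^ 2 / (y 0 ^ 2 * y 1 ^ 2))) r.domain →
        IntegrableOn h {t : Fin 3 → ℝ | (∀ i, 0 < t i) ∧ (∀ i, t i < 1) ∧ StrictAnti t}) ∧
    (∀ r r' : KZ.IntegralRep 3,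
        r.domain = {t : Fin 3 → ℝ | (∀ i, 0 < t i) ∧ (∀ i, t i < 1) ∧ StrictAnti t} →
        EqOn r.integrand (fun y => h ![1 - y 2, (y 0 - y 2) / y 0, (y 1 - y 2) / y 1] *
            (y 2 ^ 2 / (y 0 ^ 2 * y 1 ^ 2))) r.domain →
        r'.domain = {t : Fin 3 → ℝ | (∀ i, 0 < t i) ∧ (∀ i, t i < 1) ∧ StrictAnti t} →
        EqOn r'.integrand h r'.domain → KZ.of r - KZ.of r' ∈ KZ.relations) := by
  have hD : IsSemialgebraic ℚ {t : Fin 3 → ℝ | (∀ i, 0 < t i) ∧ (∀ i, t i < 1) ∧ StrictAnti t} :=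
    KZ.isSemialgebraic_openOrderedSimplex 3
  have hT := ratChart_transport (![1 - X 2, X 0 - X 2, X 1 - X 2]) (![1, X 0, X 1])
    (-(X 2 ^ 2)) (X 0 ^ 2 * X 1 ^ 2) hD cellZeta3_sigma_Q_ne_zero cellZeta3_sigma_JQ_ne_zero
    cellZeta3_sigma_det cellZeta3_sigma_injOn
    (fun y => h (fun i => aeval y ((![1 - X 2, X 0 - X 2, X 1 - X 2] : Fin 3 →
        MvPolynomial (Fin 3) ℚ) i) / aeval y ((![1, X 0, X 1] : Fin 3 → MvPolynomial (Fin 3) ℚ) i)) *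
      |aeval y (-(X 2 ^ 2) : MvPolynomial (Fin 3) ℚ) /
        aeval y (X 0 ^ 2 * X 1 ^ 2 : MvPolynomial (Fin 3) ℚ)|) h (fun y _ => rfl)
  rw [cellZeta3_sigma_image] at hT
  obtain ⟨hT1, hT2, hT3⟩ := hT
  have hg : EqOn (fun y => h (fun i => aeval y ((![1 - X 2, X 0 - X 2, X 1 - X 2] : Fin 3 →
        MvPolynomial (Fin 3) ℚ) i) / aeval y ((![1, X 0, X 1] : Fin 3 → MvPolynomial (Fin 3) ℚ) i)) *
      |aeval y (-(X 2 ^ 2) : MvPolynomial (Fin 3) ℚ) /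
        aeval y (X 0 ^ 2 * X 1 ^ 2 : MvPolynomial (Fin 3) ℚ)|)
      (fun y => h ![1 - y 2, (y 0 - y 2) / y 0, (y 1 - y 2) / y 1] *
            (y 2 ^ 2 / (y 0 ^ 2 * y 1 ^ 2)))
      {t : Fin 3 → ℝ | (∀ i, 0 < t i) ∧ (∀ i, t i < 1) ∧ StrictAnti t} := by
    intro y hy
    simp only
    rw [cellZeta3_sigma_apply, cellZeta3_sigma_absJ y hy]
  refine ⟨fun r' hd' hi' => ?_, fun r hd hi => ?_, fun r r' hd hi hd' hi' => ?_⟩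
  · obtain ⟨r, hrd, hri⟩ := hT1 r' hd' hi'
    exact ⟨r, hrd, fun y hy => by rw [hri]; exact hg (hrd ▸ hy)⟩
  · exact hT2 r hd fun y hy => (hi (hd ▸ hy : y ∈ r.domain)).trans (hg hy).symm
  · exact hT3 r r' hd (fun y hy => (hi (hd ▸ hy : y ∈ r.domain)).trans (hg hy).symm) hd' hi'


/-! ### Registered sub-goal -/

/-- Registered sub-goal `stub_cellZetaMovesThreeAux2` of this file: transport of representations,
of absolute integrability, and the change-of-variables move along the rotation `σ`
(`cellZeta3_sigma_transport`). -/
theorem stub_cellZetaMovesThreeAux2 : ∀ (h : (Fin 3 → ℝ) → ℝ), (∀ r' : Literature.NumberTheory.Transcendental.KZ.IntegralRep 3, r'.domain = {t : Fin 3 → ℝ | (∀ i, 0 < t i) ∧ (∀ i, t i < 1) ∧ StrictAnti t} → Set.EqOn r'.integrand h r'.domain → ∃ r : Literature.NumberTheory.Transcendental.KZ.IntegralRep 3, r.domain = {t : Fin 3 → ℝ | (∀ i, 0 < t i) ∧ (∀ i, t i < 1) ∧ StrictAnti t} ∧ Set.EqOn r.integrand (fun y => h ![1 - y 2, (y 0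 - y 2) / y 0, (y 1 - y 2) / y 1] * (y 2 ^ 2 / (y 0 ^ 2 * y 1 ^ 2))) r.domain) ∧ (∀ r : Literature.NumberTheory.Transcendental.KZ.IntegralRep 3, r.domain = {t : Fin 3 → ℝ | (∀ i, 0 < t i) ∧ (∀ i, t i < 1) ∧ StrictAnti t} → Set.EqOn r.integrand (fun y => h ![1 - y 2, (y 0 - y 2) / y 0, (y 1 - y 2) / y 1] * (y 2 ^ 2 / (y 0 ^ 2 * y 1 ^ 2))) r.domain → MeasureTheory.IntegrableOn h {t : Fin 3 → ℝ | (∀ i, 0 < t i) ∧ (∀ i, t i < 1) ∧ StrictAnti t} MeasureTheory.volume) ∧ (∀ r r' : Literature.NumberTheory.Transcendental.KZ.IntegralRep 3, r.domain = {t : Fin 3 → ℝ | (∀ i, 0 < t i) ∧ (∀ i, t i < 1) ∧ StrictAnti t} → Set.EqOn r.integrand (fun y => h ![1 - y 2, (y 0 - y 2) / y 0, (y 1 - y 2) / y 1] * (y 2 ^ 2 / (y 0 ^ 2 * y 1 ^ 2))) r.domain → r'.domain = {t : Fin 3 → ℝ | (∀ i, 0 < t i) ∧ (∀ i, t i < 1)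 ∧ StrictAnti t} → Set.EqOn r'.integrand h r'.domain → Literature.NumberTheory.Transcendental.KZ.of r - Literature.NumberTheory.Transcendental.KZ.of r' ∈ Literature.NumberTheory.Transcendental.KZ.relations) :=
  fun h => cellZeta3_sigma_transport h

end Summit.KontsevichZagierPeriods.DihedralNormalForm.TameBVStokes
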